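import Mathlib
import Literature.RepresentationTheory.FiniteGroups.IrreducibleCharacters
import Literature.RepresentationTheory.FiniteGroups.BrauerTheorem

/-!
# The two-piece axis family of `K × K × K`, explicitly (crux `GradedDesignFamily`, stub
# `abelianAxisFamily_of_le`, elementary route)

Route `LevelGradedCohnUmans`, crux `GradedDesignFamily` (stmt-MatrixMultiplication-7610).  The stub
`abelianAxisFamily_of_le` asks, for every real `ε ≥ 41/50`, for a finite group `G`, a
bi-invariant test space `J ≤ ℂ^G` and a finite family of triples `(X_i, Y_i, Z_i)` that is
SIMULTANEOUSLY `J`-separated (the route's cross-block `0/1` pattern) and beats the graded budget: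
`Σ_{χ ∈ Irr G ∩ J} χ(1)^{2+ε} < Σ_i (|X_i| |Y_i| |Z_i|)^{(2+ε)/3}`.

This file gives a self-contained, coordinate-explicit witness: Cohn–Kleinberg–Szegedy–Umans 2005,
Prop. 5.2 — in `G = K × K × K` (ANY group `K`, written multiplicatively; coordinate copies
`K₀ = K × 1 × 1`, `K₁`, `K₂`) the two triples `(K₀∖1, K₁∖1, K₂∖1)` and `(K₁∖1, K₂∖1, K₀∖1)`
satisfy the simultaneous triple product property.  We read it through the FULL test space
`J = ⊤`, where `J`-separation of a target `x₀⁻¹ z₀` by the delta function at `x₀⁻¹ z₀` is exactly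
the statement that a mixed quadruple product `x⁻¹ y y'⁻¹ z` hits `x₀⁻¹ z₀` only on the diagonal
(`axisPattern`, eight coordinate computations).  For the budget we take `K = C₁₇` (as
`Multiplicative (ZMod 17)`): `G` is abelian, every irreducible character has degree `1`
(`IsIrrChar.map_one`), so by `Σ χ(1)² = |G|` (`sum_sq_charDegrees_holds`) the graded budget of
`⊤` is `|G| = 17³ = 4913` at every exponent, while the family has total volume
`2 · (16³)^{(2+ε)/3} = 2 · 4096^{(2+ε)/3} ≥ 2 · 4096^{47/50}`, and `4913^{50} < 2^{50} · 4096^{47}`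
(`numeric_4913`).  (The true threshold of this witness is `ε > 0.8156…`, CKSU's `ω ≤ 2.82`.)

Design: no auxiliary definitions — the pieces are the images of `K ∖ {1}` under the explicit
coordinate embeddings `k ↦ ![(k,1,1), (1,k,1)] a` etc., so that membership unpacks uniformly in
the piece index and only the pattern lemma splits into the `2³` index cases.

[cite: CohnKleinbergSzegedyUmans2005, Prop. 5.2]
-/

noncomputable section

-- single-conjunct summit: `Summit.MatrixMultiplication.MatrixMultiplication.…` is the D-0017 layout
set_option linter.dupNamespace false

open scoped BigOperators
open Literature.RepresentationTheory.FiniteGroups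

namespace Summit.MatrixMultiplication.MatrixMultiplication.Theorems.GradedDesignFamily.AxisProduct

variable {K : Type} [Group K]

/-- **STPP of the axis family, in coordinates** (CKSU 2005, Prop. 5.2).  In `K × K × K` put
`x = X_a(s)`, `y = Y_a(t)`, `y' = Y_b(t')`, `z = Z_b(u)`, `x₀ = X_i(s₀)`, `z₀ = Z_i(u₀)` with all
parameters `≠ 1`, where piece `0` is `(K₀, K₁, K₂)` and piece `1` is `(K₁, K₂, K₀)`.  If
`x⁻¹ y y'⁻¹ z = x₀⁻¹ z₀` then `a = b = i`, `x = x₀`, `y = y'`, `z = z₀`.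
[cite: CohnKleinbergSzegedyUmans2005, Prop. 5.2] -/
theorem axisPattern (i a b : Fin 2) {s t t' u s₀ u₀ : K}
    (hs : s ≠ 1) (ht : t ≠ 1) (ht' : t' ≠ 1) (hu : u ≠ 1) (hs₀ : s₀ ≠ 1) (hu₀ : u₀ ≠ 1)
    (hE : (![((s, 1, 1) : K × K × K), (1, s, 1)] a)⁻¹ * ![((1, t, 1) : K × K × K), (1, 1, t)] a *
        (![((1, t', 1) : K × K × K), (1, 1, t')] b)⁻¹ * ![((1, 1, u) : K × K × K), (u, 1, 1)] b =
      (![((s₀, 1, 1) : K × K × K), (1, s₀, 1)] i)⁻¹ * ![((1, 1, u₀) : K × K × K), (u₀, 1, 1)] i) :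
    a = i ∧ b = i ∧
      ![((s, 1, 1) : K × K × K), (1, s, 1)] a = ![((s₀, 1, 1) : K × K × K), (1, s₀, 1)] i ∧
      ![((1, t, 1) : K × K × K), (1, 1, t)] a = ![((1, t', 1) : K × K × K), (1, 1, t')] b ∧
      ![((1, 1, u) : K × K × K), (u, 1, 1)] b = ![((1, 1, u₀) : K × K × K), (u₀, 1, 1)] i := by
  fin_cases i <;> fin_cases a <;> fin_cases b <;>
    simp only [Fin.zero_eta, Fin.mk_one, Fin.isValue, Matrix.cons_val_zero, Matrix.cons_val_one,
      Prod.inv_mk, Prod.mk_mul_mk, inv_one, mul_one, one_mul, mul_inv_eq_one, Prod.mk.injEq]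
      at hE ⊢ <;>
    simp_all

/-- A punctured coordinate copy of `K` inside `K × K × K` has `|K| - 1` elements. [folklore] -/
theorem card_image_ne_one [Fintype K] [DecidableEq K] {f : K → K × K × K}
    (hf : Function.Injective f) :
    ((Finset.univ.filter fun k : K => k ≠ 1).image f).card = Fintype.card K - 1 := by
  rw [Finset.card_image_of_injective _ hf, Finset.filter_ne' Finset.univ (1 : K),
    Finset.card_erase_of_mem (Finset.mem_univ _), Finset.card_univ]

/-- The arithmetic of the witness: `4913 < 2 · 4096^e` for every real `e ≥ 47/50`
(monotonicity in `e`, and `4913^{50} < 2^{50} · 4096^{47}`). [folklore] -/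
theorem numeric_4913 (e : ℝ) (he : (47 : ℝ) / 50 ≤ e) :
    (4913 : ℝ) < (4096 : ℝ) ^ e + (4096 : ℝ) ^ e := by
  have hmono : (4096 : ℝ) ^ ((47 : ℝ) / 50) ≤ (4096 : ℝ) ^ e :=
    Real.rpow_le_rpow_of_exponent_le (by norm_num) he
  have hkey : (4913 : ℝ) < 2 * (4096 : ℝ) ^ ((47 : ℝ) / 50) := by
    have h0 : (0 : ℝ) ≤ 2 * (4096 : ℝ) ^ ((47 : ℝ) / 50) := by positivity
    refine lt_of_pow_lt_pow_left₀ 50 h0 ?_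
    rw [mul_pow, ← Real.rpow_natCast ((4096 : ℝ) ^ ((47 : ℝ) / 50)) 50,
      ← Real.rpow_mul (by norm_num : (0 : ℝ) ≤ 4096),
      show ((47 : ℝ) / 50 * ((50 : ℕ) : ℝ)) = ((47 : ℕ) : ℝ) by norm_num, Real.rpow_natCast]
    norm_num
  linarith

/-- **`abelianAxisFamily_of_le`** (registered stub of crux `GradedDesignFamily`, line `Sketch`):
for every `ε ≥ 41/50` the two-piece axis family of `C₁₇ × C₁₇ × C₁₇`
(`K = Multiplicative (ZMod 17)`), read through the full test space `J = ⊤`, is a bi-invariant,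
simultaneously `J`-separated family whose total volume `2 · 4096^{(2+ε)/3}` exceeds the graded
budget `Σ_{χ ∈ Irr} χ(1)^{2+ε} = 17³ = 4913`.  Cohn–Kleinberg–Szegedy–Umans 2005, Prop. 5.2 (the
first STPP example, `ω ≤ 2.82`), here with an explicit coordinate proof of the STPP (`axisPattern`)
and the exact budget count via `Σ χ(1)² = |G|`. [cite: CohnKleinbergSzegedyUmans2005, Prop. 5.2] -/
theorem abelianAxisFamily_of_le (ε : ℝ) (hε : (41 : ℝ) / 50 ≤ ε) :
    ∃ (G : Type) (_ : Group G) (_ : Fintype G)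
      (J : Submodule ℂ (G → ℂ)) (t : ℕ) (X Y Z : Fin t → Finset G),
      (∀ f ∈ J, ∀ a b : G, (fun g : G => f (a * g * b)) ∈ J) ∧
      (∀ i : Fin t, ∀ x₀ ∈ X i, ∀ z₀ ∈ Z i, ∃ f ∈ J, ∀ a b : Fin t, ∀ x ∈ X a, ∀ y ∈ Y a,
        ∀ y' ∈ Y b, ∀ z ∈ Z b,
          ((a = i ∧ b = i ∧ x = x₀ ∧ y = y' ∧ z = z₀) → f (x⁻¹ * y * y'⁻¹ * z) = 1) ∧
          (¬ (a = i ∧ b = i ∧ x = x₀ ∧ y = y' ∧ z = z₀) → f (x⁻¹ * y * y'⁻¹ * z) = 0)) ∧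
      (∑ᶠ χ ∈ irrChars G ∩ (J : Set (G → ℂ)), (χ 1).re ^ (2 + ε)) <
        ∑ i, (((X i).card * (Y i).card * (Z i).card : ℕ) : ℝ) ^ ((2 + ε) / 3) := by
  refine ⟨Multiplicative (ZMod 17) × Multiplicative (ZMod 17) × Multiplicative (ZMod 17),
    inferInstance, inferInstance, ⊤, 2,
    fun a => (Finset.univ.filter fun k : Multiplicative (ZMod 17) => k ≠ 1).image fun k =>
      ![((k, 1, 1) :
        Multiplicative (ZMod 17) × Multiplicative (ZMod 17) × Multiplicative (ZMod 17)),
        (1, k, 1)] a,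
    fun a => (Finset.univ.filter fun k : Multiplicative (ZMod 17) => k ≠ 1).image fun k =>
      ![((1, k, 1) :
        Multiplicative (ZMod 17) × Multiplicative (ZMod 17) × Multiplicative (ZMod 17)),
        (1, 1, k)] a,
    fun a => (Finset.univ.filter fun k : Multiplicative (ZMod 17) => k ≠ 1).image fun k =>
      ![((1, 1, k) :
        Multiplicative (ZMod 17) × Multiplicative (ZMod 17) × Multiplicative (ZMod 17)),
        (k, 1, 1)] a,
    fun f _ _ _ => Submodule.mem_top, ?_, ?_⟩
  · -- simultaneous separation by the delta function at the target (the STPP, `axisPattern`)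
    intro i x₀ hx₀ z₀ hz₀
    refine ⟨fun g => if g = x₀⁻¹ * z₀ then 1 else 0, Submodule.mem_top, ?_⟩
    intro a b x hx y hy y' hy' z hz
    refine ⟨?_, fun hnot => ?_⟩
    · rintro ⟨-, -, rfl, rfl, rfl⟩
      simp
    · show (if x⁻¹ * y * y'⁻¹ * z = x₀⁻¹ * z₀ then (1 : ℂ) else 0) = 0
      rw [if_neg]
      intro hq
      apply hnot
      simp only [Finset.mem_image, Finset.mem_filter, Finset.mem_univ, true_and]
        at hx hy hy' hz hx₀ hz₀
      obtain ⟨s, hs, rfl⟩ := hx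
      obtain ⟨t, ht, rfl⟩ := hy
      obtain ⟨t', ht', rfl⟩ := hy'
      obtain ⟨u, hu, rfl⟩ := hz
      obtain ⟨s₀, hs₀, rfl⟩ := hx₀
      obtain ⟨u₀, hu₀, rfl⟩ := hz₀
      exact axisPattern i a b hs ht ht' hu hs₀ hu₀ hq
  · -- budget `= 17³ = 4913` (all degrees `1`, `Σ χ(1)² = |G|`) against volume `2 · 4096^{(2+ε)/3}`
    have hfin := irrChars_finite_holds
      (Multiplicative (ZMod 17) × Multiplicative (ZMod 17) × Multiplicative (ZMod 17))
    have hbudget : (∑ᶠ χ ∈ irrChars (Multiplicative (ZMod 17) × Multiplicative (ZMod 17) ×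
          Multiplicative (ZMod 17)) ∩ ((⊤ : Submodule ℂ (Multiplicative (ZMod 17) ×
            Multiplicative (ZMod 17) × Multiplicative (ZMod 17) → ℂ)) : Set _),
          (χ 1).re ^ (2 + ε)) = 4913 := by
      rw [Submodule.top_coe, Set.inter_univ, finsum_mem_eq_finite_toFinset_sum _ hfin]
      have hone : ∀ χ ∈ hfin.toFinset, (χ 1).re ^ (2 + ε) = 1 := fun χ hχ => by
        rw [IsIrrChar.map_one (hfin.mem_toFinset.mp hχ), Complex.one_re, Real.one_rpow]
      rw [Finset.sum_congr rfl hone, Finset.sum_const, nsmul_eq_mul, mul_one]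
      -- the number of irreducible characters is `|G| = 17³`, from `Σ χ(1)² = |G|` with `χ(1) = 1`
      have hsq := sum_sq_charDegrees_holds
        (Multiplicative (ZMod 17) × Multiplicative (ZMod 17) × Multiplicative (ZMod 17))
      rw [finsum_mem_eq_finite_toFinset_sum _ hfin] at hsq
      have hone' : ∀ χ ∈ hfin.toFinset, χ 1 ^ 2 = (1 : ℂ) := fun χ hχ => by
        rw [IsIrrChar.map_one (hfin.mem_toFinset.mp hχ), one_pow]
      rw [Finset.sum_congr rfl hone', Finset.sum_const, nsmul_eq_mul, mul_one,
        Nat.card_eq_fintype_card, Fintype.card_prod, Fintype.card_prod,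
        Fintype.card_multiplicative, ZMod.card] at hsq
      have hcardT : hfin.toFinset.card = 17 * (17 * 17) := by exact_mod_cast hsq
      rw [hcardT]
      norm_num
    rw [hbudget]
    -- the three coordinate embeddings are injective, so every piece has `17 - 1 = 16` elements
    have h0 : Function.Injective fun k : Multiplicative (ZMod 17) =>
        ((k, 1, 1) :
          Multiplicative (ZMod 17) × Multiplicative (ZMod 17) × Multiplicative (ZMod 17)) :=
      fun k k' h => (Prod.mk.inj h).1
    have h1 : Function.Injective fun k : Multiplicative (ZMod 17) =>
        ((1, k, 1) :
          Multiplicative (ZMod 17) × Multiplicative (ZMod 17) × Multiplicative (ZMod 17)) :=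
      fun k k' h => (Prod.mk.inj (Prod.mk.inj h).2).1
    have h2 : Function.Injective fun k : Multiplicative (ZMod 17) =>
        ((1, 1, k) :
          Multiplicative (ZMod 17) × Multiplicative (ZMod 17) × Multiplicative (ZMod 17)) :=
      fun k k' h => (Prod.mk.inj (Prod.mk.inj h).2).2
    simp only [Fin.sum_univ_two, Fin.isValue, Matrix.cons_val_zero, Matrix.cons_val_one,
      card_image_ne_one h0, card_image_ne_one h1, card_image_ne_one h2,
      Fintype.card_multiplicative, ZMod.card]
    have he : (47 : ℝ) / 50 ≤ (2 + ε) / 3 := by linarith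
    have := numeric_4913 ((2 + ε) / 3) he
    exact this

end Summit.MatrixMultiplication.MatrixMultiplication.Theorems.GradedDesignFamily.AxisProduct

end
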